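import Literature.Topology.FourManifolds.FlowerReflectionAccessPath
import Literature.Topology.FourManifolds.DehnNielsenBaerMarkingActions
import Literature.Topology.FourManifolds.SurfaceGroupReflection
import Literature.AlgebraicTopology.FundamentalGroup.BasePointTransfer
import Literature.AlgebraicTopology.FundamentalGroup.SpunFundamentalGroup
import HarnessLib

/-!
# Dehn–Nielsen–Baer on the flower surface: the reflection acts on the marking by `reflEquiv`

Topic `Literature/Topology/FourManifolds`; PROOF file of the named fact
`Literature.Topology.FourManifolds.DehnNielsenBaerSurfaceSmooth` (`DehnNielsenBaerSurface.lean`), third item of the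
`π₁`-bookkeeping (W2): among the realised classes of `dehnNielsenBaerSurfaceSmooth_of_flower_generators_symm`
is `σ_#`, `σ = refl3 : (x, y, z) ↦ (x, -y, z)`.  On the marking `ν = FlowerModel.marking n`
(`DehnNielsenBaerMarkingActions.lean`) it is computed here:

* §1 `FlowerModel.mapOfEq_pathConj_fromPath` — transport naturality with a moved access path:
  for a self-map `f` fixing the two ends `t, P` of a path `G`,
  `f_# (G · γ · G⁻¹) = G · (W · f(γ) · W⁻¹) · G⁻¹` with `W = G⁻¹ · f(G)` (pure groupoid algebra);
* §2 the sector: `σZ`, and **`σ_* A = B A B⁻¹`, `σ_* B = B⁻¹`** on the transported basis classes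
  `A = θ(a), B = θ(b)` of `π₁(sector, 0⁺)` (`mapOfEq_σZ_sectorZGenClass_false/_true`) — from
  `cl_map_refl3_loopR_false/_true` (`σ` fixes the `a`-loop, reverses the `b`-loop) and
  `cl_gam_symm_trans_refl3Gam` (`W = [γ⁻¹σ(γ)] = B⁻¹`);
* §3 the flower surface: `reflS`, `σ ∘ R_k = R_m ∘ σ` for `m + k ≡ 0 (mod g)` and the values
  `σ_* (ι_k θ_k(x)) = ι_m (R_m)_* (σ_* θ_0(x))`;
* §4 the boundary manifold: **`(σ)_# ∘ ν = ν ∘ SurfaceGroup.reflEquiv`**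
  (`fundamentalGroupCongr_reflBoundary_marking`), `reflEquiv : a_k ↦ b_{-k} a_{-k} b_{-k}⁻¹`,
  `b_k ↦ b_{-k}⁻¹` (`SurfaceGroupReflection.lean`).

Everything is proved; no named facts (D-0026).

## References

* B. Farb, D. Margalit, *A primer on mapping class groups* (2012), Thm. 8.1. [FarbMargalit2012]
* H. Zieschang, E. Vogt, H.-D. Coldewey, *Surfaces and Planar Discontinuous Groups*, LNM 835 (1980),
  §3.2, Thm. 5.6.1. [ZieschangVogtColdewey1980]
* A. Hatcher, *Algebraic Topology* (2002), Prop. 1.5, Prop. 1.17. [HatcherAT2002]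
-/

open scoped Manifold ContDiff Topology Real unitInterval
open Set Function Filter

noncomputable section

namespace Literature.Topology.FourManifolds

/-- Local notation: `𝔼 n` is the model Euclidean space `EuclideanSpace ℝ (Fin n)`. -/
local notation "𝔼 " n:arg => EuclideanSpace ℝ (Fin n)

open PlanarThickening Literature.AlgebraicTopology.Homotopy Literature.AlgebraicTopology.FundamentalGroup
  Literature.AlgebraicTopology.FundamentalGroup.EdgePath
  Literature.AlgebraicTopology.FundamentalGroup.BasePointTransfer

namespace FlowerModel

variable {g : ℕ}

/-! ### §1 Transport naturality with a moved access path -/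

section Transport

variable {Y : Type*} [TopologicalSpace Y]

/-- `pathConj G` on the class of a loop, at the level of the homotopy quotient. [folklore] -/
theorem pathConj_fromPath_quotient {t P : Y} (G : Path t P) (q : Path.Homotopic.Quotient P P) :
    pathConj G (FundamentalGroup.fromPath q) =
      FundamentalGroup.fromPath ((Path.Homotopic.Quotient.mk G).trans
        (q.trans (Path.Homotopic.Quotient.mk G).symm)) := by
  induction q using Quotient.ind with | _ γ =>
  show pathConj G (FundamentalGroup.fromPath (Path.Homotopic.Quotient.mk γ)) = _
  rw [pathConj_fromPath, Path.Homotopic.Quotient.mk_trans, Path.Homotopic.Quotient.mk_trans,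
    Path.Homotopic.Quotient.mk_symm]
  rfl

/-- **Transport naturality with a moved access path.**  For a self-map `f` fixing the end points
`t`, `P` of a path `G : t ⟶ P` and a loop `γ` at `P`:
`f_# [G · γ · G⁻¹] = [G · (W · f(γ) · W⁻¹) · G⁻¹]` with `W = G⁻¹ · f(G)`. [cite: HatcherAT2002, Prop. 1.5] -/
theorem mapOfEq_pathConj_fromPath (f : C(Y, Y)) {t P : Y} (ht : f t = t) (hP : f P = P)
    (G : Path t P) (γ : Path P P) :
    FundamentalGroup.mapOfEq f ht (pathConj G (FundamentalGroup.fromPath (Path.Homotopic.Quotient.mk γ))) =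
      pathConj G (FundamentalGroup.fromPath
        ((Path.Homotopic.Quotient.mk (G.symm.trans ((G.map f.continuous).cast ht.symm hP.symm))).trans
          ((Path.Homotopic.Quotient.mk ((γ.map f.continuous).cast hP.symm hP.symm)).trans
            (Path.Homotopic.Quotient.mk (G.symm.trans ((G.map f.continuous).cast ht.symm hP.symm))).symm))) := by
  rw [pathConj_fromPath, mapOfEq_fromPath, pathConj_fromPath_quotient]
  -- everything at the level of the homotopy quotient of explicit paths
  have e : ((G.trans (γ.trans G.symm)).map f.continuous).cast ht.symm ht.symm =
      ((G.map f.continuous).cast ht.symm hP.symm).trans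
        (((γ.map f.continuous).cast hP.symm hP.symm).trans ((G.map f.continuous).cast ht.symm hP.symm).symm) := by
    apply Path.ext
    funext s
    simp only [Path.cast_coe, Path.map_coe, comp_apply, Path.trans_apply, Path.symm_apply]
    split_ifs <;> rfl
  rw [e]
  simp only [Path.Homotopic.Quotient.mk_trans, Path.Homotopic.Quotient.mk_symm,
    Path.Homotopic.Quotient.trans_assoc, quot_symm_trans, quot_symm_symm,
    Path.Homotopic.Quotient.trans_symm, Path.Homotopic.Quotient.trans_refl]
  rw [← Path.Homotopic.Quotient.trans_assoc (Path.Homotopic.Quotient.mk G)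
      (Path.Homotopic.Quotient.mk G).symm _, Path.Homotopic.Quotient.trans_symm,
    Path.Homotopic.Quotient.refl_trans]

end Transport

/-! ### §2 The reflection on the transported basis classes of the sector -/

/-- **The reflection `σ` of the sector** as a self-map. [folklore] -/
def σZ (hg : 2 ≤ g) : C(sectorZ g, sectorZ g) :=
  ⟨fun z => ⟨refl3 z.1, refl3_mem_sectorZ hg z.2⟩,
    (refl3.continuous.comp continuous_subtype_val).subtype_mk _⟩

/-- `σ` on points of the sector. [folklore] -/
@[simp] theorem σZ_apply_coe (hg : 2 ≤ g) (z : sectorZ g) : ((σZ hg z : sectorZ g) : 𝔼 3) = refl3 z.1 := rfl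

/-- `σ` fixes the pole. [folklore] -/
theorem σZ_top (hg : 2 ≤ g) (h : top g ∈ sectorZ g) : σZ hg ⟨top g, h⟩ = ⟨top g, h⟩ :=
  Subtype.ext (refl3_top g)

/-- `σ` fixes `P`. [folklore] -/
theorem σZ_ptP (hg : 2 ≤ g) (h : ptP g ∈ sectorZ g) : σZ hg ⟨ptP g, h⟩ = ⟨ptP g, h⟩ :=
  Subtype.ext (refl3_ptP g)

/-- `(β_{G})⁻¹ ∘ β_{G⁻¹}`-bookkeeping: transporting along `G⁻¹` is `pathConj G`. [folklore] -/
theorem fundamentalGroupMulEquivOfPath_symm_eq_pathConj {Y : Type*} [TopologicalSpace Y] {t P : Y}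
    (G : Path t P) (x : FundamentalGroup Y P) :
    FundamentalGroup.fundamentalGroupMulEquivOfPath G.symm x = pathConj G x := by
  apply (FundamentalGroup.fundamentalGroupMulEquivOfPath G).injective
  rw [MulEquiv.apply_symm_apply]
  induction x using Quotient.ind with | _ α =>
  show FundamentalGroup.fundamentalGroupMulEquivOfPath G (FundamentalGroup.fundamentalGroupMulEquivOfPath G.symm
    (FundamentalGroup.fromPath (Path.Homotopic.Quotient.mk α))) = FundamentalGroup.fromPath (Path.Homotopic.Quotient.mk α)
  change FundamentalGroup.fromPath (Path.Homotopic.Quotient.mk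
    (G.symm.trans ((G.symm.symm.trans (α.trans G.symm)).trans G))) = _
  simp only [Path.Homotopic.Quotient.mk_trans, Path.Homotopic.Quotient.mk_symm, quot_symm_symm,
    Path.Homotopic.Quotient.trans_assoc, Path.Homotopic.Quotient.symm_trans,
    Path.Homotopic.Quotient.trans_refl]
  rw [← Path.Homotopic.Quotient.trans_assoc (Path.Homotopic.Quotient.mk G).symm
      (Path.Homotopic.Quotient.mk G) _, Path.Homotopic.Quotient.symm_trans,
    Path.Homotopic.Quotient.refl_trans]

/-- The transported basis classes are `pathConj γ` of the classes of the basis loops. [folklore] -/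
theorem sectorZGenClass_eq_pathConj (hg : 2 ≤ g) (i : surfaceGen 1) :
    sectorZGenClass hg i =
      pathConj (VanKampen.liftPath (sectorZ g) (gam hg) (gam_mem hg))
        (FundamentalGroup.fromPath (cl (loopR hg i) (loopR_mem_sectorZ hg i))) :=
  fundamentalGroupMulEquivOfPath_symm_eq_pathConj _ _

/-- The moved access path of §1 for `σ` is `γ⁻¹ · σ(γ)`. [folklore] -/
theorem mk_accessLoop_σZ (hg : 2 ≤ g) :
    Path.Homotopic.Quotient.mk ((VanKampen.liftPath (sectorZ g) (gam hg) (gam_mem hg)).symm.trans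
        (((VanKampen.liftPath (sectorZ g) (gam hg) (gam_mem hg)).map (σZ hg).continuous).cast
          (σZ_top hg (top_mem_sectorZ hg)).symm (σZ_ptP hg (ptP_mem_sectorZ hg)).symm)) =
      cl ((gam hg).symm.trans (refl3Gam hg)) (gam_symm_trans_refl3Gam_mem hg) := by
  rw [← cl_trans _ _ (VanKampen.symm_mem (gam_mem hg)) (refl3Gam_mem hg), ← cl_symm _ (gam_mem hg),
    Path.Homotopic.Quotient.mk_trans, Path.Homotopic.Quotient.mk_symm]
  exact congrArg (fun q => (Path.Homotopic.Quotient.mk (VanKampen.liftPath (sectorZ g) (gam hg) (gam_mem hg))).symm.trans q)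
    (congrArg Path.Homotopic.Quotient.mk (Path.ext (funext fun _ => rfl)))

/-- The moved loop of §1 for `σ` is `σ ∘ loopR i`. [folklore] -/
theorem mk_map_σZ_loopR (hg : 2 ≤ g) (i : surfaceGen 1) :
    Path.Homotopic.Quotient.mk ((((VanKampen.liftPath (sectorZ g) (loopR hg i) (loopR_mem_sectorZ hg i)).map
        (σZ hg).continuous).cast (σZ_ptP hg (ptP_mem_sectorZ hg)).symm (σZ_ptP hg (ptP_mem_sectorZ hg)).symm)) =
      cl (((loopR hg i).map refl3.continuous).cast (refl3_ptP g).symm (refl3_ptP g).symm)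
        (map_refl3_loopR_mem hg i) :=
  congrArg Path.Homotopic.Quotient.mk (Path.ext (funext fun _ => rfl))

/-- **The master formula**: `σ_* θ(i) = β_γ (B⁻¹ · σ(ℓ_i) · B)` where `B = [loopR b]` and
`σ(ℓ_i)` is the reflected basis loop. [cite: ZieschangVogtColdewey1980, §3.2] -/
theorem mapOfEq_σZ_sectorZGenClass (hg : 2 ≤ g) (i : surfaceGen 1) :
    FundamentalGroup.mapOfEq (σZ hg) (σZ_top hg (top_mem_sectorZ hg)) (sectorZGenClass hg i) =
      pathConj (VanKampen.liftPath (sectorZ g) (gam hg) (gam_mem hg))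
        (FundamentalGroup.fromPath ((cl (loopR hg (0, true)) (loopR_mem_sectorZ hg (0, true))).symm.trans
          ((cl (((loopR hg i).map refl3.continuous).cast (refl3_ptP g).symm (refl3_ptP g).symm)
            (map_refl3_loopR_mem hg i)).trans (cl (loopR hg (0, true)) (loopR_mem_sectorZ hg (0, true)))))) := by
  rw [sectorZGenClass_eq_pathConj,
    mapOfEq_pathConj_fromPath (σZ hg) (σZ_top hg (top_mem_sectorZ hg)) (σZ_ptP hg (ptP_mem_sectorZ hg)),
    mk_accessLoop_σZ, mk_map_σZ_loopR, cl_gam_symm_trans_refl3Gam, quot_symm_symm]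

/-- **`σ_* A = B · A · B⁻¹`** on `π₁(sector, 0⁺)` (`A = θ(a)`, `B = θ(b)`).
[cite: ZieschangVogtColdewey1980, §3.2] -/
theorem mapOfEq_σZ_sectorZGenClass_false (hg : 2 ≤ g) (j : Fin 1) :
    FundamentalGroup.mapOfEq (σZ hg) (σZ_top hg (top_mem_sectorZ hg)) (sectorZGenClass hg (j, false)) =
      sectorZGenClass hg (0, true) * sectorZGenClass hg (j, false) * (sectorZGenClass hg (0, true))⁻¹ := by
  rw [mapOfEq_σZ_sectorZGenClass, cl_map_refl3_loopR_false, sectorZGenClass_eq_pathConj,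
    sectorZGenClass_eq_pathConj, ← map_mul, ← map_inv, ← map_mul]
  rfl

/-- **`σ_* B = B⁻¹`** on `π₁(sector, 0⁺)`. [cite: ZieschangVogtColdewey1980, §3.2] -/
theorem mapOfEq_σZ_sectorZGenClass_true (hg : 2 ≤ g) (j : Fin 1) :
    FundamentalGroup.mapOfEq (σZ hg) (σZ_top hg (top_mem_sectorZ hg)) (sectorZGenClass hg (j, true)) =
      (sectorZGenClass hg (0, true))⁻¹ := by
  obtain rfl : j = 0 := Subsingleton.elim _ _
  rw [mapOfEq_σZ_sectorZGenClass, cl_map_refl3_loopR_true, sectorZGenClass_eq_pathConj, ← map_inv]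
  congr 1
  show FundamentalGroup.fromPath _ = FundamentalGroup.fromPath _
  rw [Path.Homotopic.Quotient.symm_trans, Path.Homotopic.Quotient.trans_refl]
  rfl


/-! ### §3 The reflection of the flower surface and the slices -/

/-- `σ` preserves the flower surface. [folklore] -/
theorem refl3_mem_flowerSurface' {p : 𝔼 3} (hp : p ∈ flowerSurface g) : refl3 p ∈ flowerSurface g := by
  rw [flowerSurface_def] at hp ⊢
  show thicken (flower g) (refl3 p) = level g
  rw [thicken_flower_refl3]
  exact hp

/-- **The reflection `σ` of the flower surface** as a self-map. [folklore] -/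
def reflS (g : ℕ) : C(flowerSurface g, flowerSurface g) :=
  ⟨fun z => ⟨refl3 z.1, refl3_mem_flowerSurface' z.2⟩,
    (refl3.continuous.comp continuous_subtype_val).subtype_mk _⟩

/-- `σ` on points. [folklore] -/
@[simp] theorem reflS_apply_coe (z : flowerSurface g) : ((reflS g z : flowerSurface g) : 𝔼 3) = refl3 z.1 := rfl

/-- `σ` fixes the pole. [folklore] -/
theorem reflS_top (h : top g ∈ flowerSurface g) : reflS g ⟨top g, h⟩ = ⟨top g, h⟩ :=
  Subtype.ext (refl3_top g)

/-- **`σ ∘ R_k = R_m ∘ σ` for `m + k ≡ 0 (mod g)`** (`R_k = rot3 (ζ^k)⁻¹`, `σ ρ = ρ⁻¹ σ`). [folklore] -/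
theorem refl3_Rk (hg : 1 ≤ g) {k m : ℕ} (h : (m + k) % g = 0) (p : 𝔼 3) :
    refl3 (Rk g k p) = Rk g m (refl3 p) := by
  have hζ : ζC g m * ζC g k = 1 := by
    rw [← ζC_add, ζC_eq_of_mod_eq hg (h.trans (Nat.zero_mod g).symm)]
    apply Subtype.ext
    simp [coe_ζC]
  have hinv : (ζC g m)⁻¹ = ζC g k := by
    rw [inv_eq_iff_mul_eq_one, hζ]
  show lift3 refl (lift3 (rot (ζC g k)⁻¹) p) = lift3 (rot (ζC g m)⁻¹) (lift3 refl p)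
  rw [lift3_lift3, lift3_lift3, hinv]
  congr 1
  funext u
  rw [comp_apply, comp_apply, refl_rot, inv_inv]

/-- **The reflection on the marking values**: `σ_* (ι_k θ_k(i)) = ι_m (R_m)_* (σ_* θ_0(i))` for
`m + k ≡ 0 (mod g)` — `σ` carries the `k`-th slice onto the `m`-th, and on the standard sector it is
`σZ`. [cite: FarbMargalit2012, Thm. 8.1] -/
theorem mapOfEq_reflS_secSGenClass (hg : 2 ≤ g) {k m : ℕ} (h : (m + k) % g = 0)
    (htop : top g ∈ flowerSurface g) (hk : secS g k ⊆ flowerSurface g)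
    (hm : secS g m ⊆ flowerSurface g) (i : surfaceGen 1) :
    FundamentalGroup.mapOfEq (reflS g) (reflS_top htop)
        (VanKampen.inclHomOfSubset hk (top g) (range_arcK_subset hg k ⟨0, (arcK hg k).source⟩) htop
          (secSGenClass hg k i)) =
      VanKampen.inclHomOfSubset hm (top g) (range_arcK_subset hg m ⟨0, (arcK hg m).source⟩) htop
        (fundamentalGroupEquivOfHomeomorph (RkHomeo g m) (RkHomeo_top hg m)
          (FundamentalGroup.mapOfEq (σZ hg) (σZ_top hg (top_mem_sectorZ hg)) (sectorZGenClass hg i))) := by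
  have hg1 : 1 ≤ g := by omega
  simp only [secSGenClass, fundamentalGroupEquivOfHomeomorph_apply, VanKampen.inclHomOfSubset]
  rw [← mapOfEq_comp_apply, ← mapOfEq_comp_apply, ← mapOfEq_comp_apply, ← mapOfEq_comp_apply]
  refine mapOfEq_congr_map (ContinuousMap.ext fun p => Subtype.ext ?_) _ _ _
  show refl3 (Rk g k p.1) = Rk g m (refl3 p.1)
  exact refl3_Rk hg1 h p.1

/-! ### §4 The reflection acts on the marking by `reflEquiv` -/

/-- Under `∂V_g ≃ₜ Z_g`, the reflection of `∂V_g` is the reflection of `Z_g` (on `π₁`). [folklore] -/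
theorem mapOfEq_boundaryHomeomorph_reflBoundary (hg : 2 ≤ g)
    (γ : FundamentalGroup ((𝓡∂ 3).boundary (FlowerHandlebody hg)) (northPole hg)) :
    fundamentalGroupEquivOfHomeomorph (boundaryHomeomorph hg) (boundaryHomeomorph_northPole hg)
        (Homeomorph.fundamentalGroupCongr (reflBoundary hg).toHomeomorph (reflBoundary_northPole hg) γ) =
      FundamentalGroup.mapOfEq (reflS g) (reflS_top (top_mem_flowerSurface hg))
        (fundamentalGroupEquivOfHomeomorph (boundaryHomeomorph hg) (boundaryHomeomorph_northPole hg) γ) := by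
  simp only [fundamentalGroupEquivOfHomeomorph_apply, Homeomorph.fundamentalGroupCongr_apply]
  refine ((mapOfEq_comp_apply _ _ (reflBoundary_northPole hg) (boundaryHomeomorph_northPole hg)
    γ).symm.trans ?_).trans (mapOfEq_comp_apply _ _ (boundaryHomeomorph_northPole hg)
      (reflS_top (top_mem_flowerSurface hg)) γ)
  exact mapOfEq_congr_map (ContinuousMap.ext fun z => Subtype.ext (boundaryIncl_reflBoundary hg z)) _ _ _

/-- The marking value of a generator, read on `Z`, in `(R_k)_* θ` form. [folklore] -/
theorem marking_of' (n : ℕ) (k : Fin (n + 1 + 1)) (c : Bool) :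
    fundamentalGroupEquivOfHomeomorph (boundaryHomeomorph (show 2 ≤ n + 2 by omega))
        (boundaryHomeomorph_northPole (show 2 ≤ n + 2 by omega))
        (marking n (PresentedGroup.of (k, c))) =
      VanKampen.inclHomOfSubset
        ((flowerSurface_marking_values (show 2 ≤ n + 2 by omega)).choose_spec.choose k
          (Nat.lt_succ_iff.1 k.2)) (top (n + 2))
        (range_arcK_subset (show 2 ≤ n + 2 by omega) k ⟨0, (arcK (show 2 ≤ n + 2 by omega) k).source⟩)
        (top_mem_flowerSurface (show 2 ≤ n + 2 by omega))
        (secSGenClass (show 2 ≤ n + 2 by omega) k (0, c)) := by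
  have h := marking_of n (Nat.lt_succ_iff.1 k.2) c
  simp only [Fin.eta] at h
  exact h

/-- **On the marking, `σ_#` is the reflection involution `reflEquiv`**:
`σ_# (ν x) = ν (reflEquiv x)`, `reflEquiv : a_k ↦ b_{-k} a_{-k} b_{-k}⁻¹`, `b_k ↦ b_{-k}⁻¹`
(`SurfaceGroupReflection.lean`). [cite: FarbMargalit2012, Thm. 8.1] [cite: ZieschangVogtColdewey1980, §3.2] -/
theorem fundamentalGroupCongr_reflBoundary_marking (n : ℕ) (x : SurfaceGroup (n + 1 + 1)) :
    Homeomorph.fundamentalGroupCongr (reflBoundary (show 2 ≤ n + 2 by omega)).toHomeomorph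
        (reflBoundary_northPole (show 2 ≤ n + 2 by omega)) (marking n x) =
      marking n (SurfaceGroup.reflEquiv (n + 1 + 1) x) := by
  set hg : 2 ≤ n + 2 := show 2 ≤ n + 2 by omega
  suffices h : ((Homeomorph.fundamentalGroupCongr (reflBoundary hg).toHomeomorph
        (reflBoundary_northPole hg)).toMonoidHom.comp (marking n).toMonoidHom) =
      (marking n).toMonoidHom.comp (SurfaceGroup.reflEquiv (n + 1 + 1)).toMonoidHom by
    exact DFunLike.congr_fun h x
  refine PresentedGroup.ext fun p => ?_
  obtain ⟨k, c⟩ := p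
  simp only [MonoidHom.coe_comp, MulEquiv.coe_toMonoidHom, comp_apply, SurfaceGroup.reflEquiv_of]
  -- read everything on `Z` through `boundaryHomeomorph`
  set E := fundamentalGroupEquivOfHomeomorph (boundaryHomeomorph hg) (boundaryHomeomorph_northPole hg) with hE
  apply E.injective
  rw [mapOfEq_boundaryHomeomorph_reflBoundary, marking_of' n k c]
  -- the index `m = -k`
  set m : Fin (n + 1 + 1) := SurfaceGroup.negFin k with hmdef
  have hmk : ((m : ℕ) + k) % (n + 2) = 0 := by
    rw [hmdef, SurfaceGroup.val_negFin, Nat.mod_add_mod, Nat.sub_add_cancel k.2.le, Nat.mod_self]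
  rw [mapOfEq_reflS_secSGenClass hg hmk _ _
      ((flowerSurface_marking_values hg).choose_spec.choose m (Nat.lt_succ_iff.1 m.2))]
  cases c
  · -- `a_k ↦ b_m a_m b_m⁻¹`
    rw [SurfaceGroup.reflGens_false, map_mul, map_mul, map_inv, map_mul, map_mul, map_inv,
      SurfaceGroup.a, SurfaceGroup.b, marking_of' n m true, marking_of' n m false,
      mapOfEq_σZ_sectorZGenClass_false, map_mul, map_mul, map_inv, map_mul, map_mul, map_inv]
    rfl
  · -- `b_k ↦ b_m⁻¹`
    rw [SurfaceGroup.reflGens_true, map_inv, map_inv, SurfaceGroup.b, marking_of' n m true,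
      mapOfEq_σZ_sectorZGenClass_true, map_inv, map_inv]
    rfl


end FlowerModel

end Literature.Topology.FourManifolds

end
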